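import Summits.ABC.ABC.Theses.DefiniteXi
import Summits.ABC.ABC.Theorems.DefiniteXiXiStrongBoundAllTamExp
import HarnessLib

/-!
# Crux `SteinbergCore` (stmt-ABC-15024) — the strategist's typed split (glue for `route edit --split`)

Glue for the DECOMPOSITION of the crux `Summit.ABC.ABC.Theses.DefiniteXi.SteinbergCore` (stmt-ABC-15024, route
ABC/DefiniteXi, rank 6) into three leaf statements, recorded by the crux-strategist seat after the crux chain was
declared exhausted (two ideation rounds, triage panels r1-1/2/3 and r2-1/2, line `Sketch` dead at `stub_ledgerCore`;
`Cruxes/SteinbergCore/STRATEGY-CENSUS.md`).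

The crux reads, for coprime `a, b` (`ab(a+b) ≠ 0`), `N` the conductor of the Frey curve `E_(a,b) = freyCurve a b`, every
admissible quarantine `Nm` (odd, squarefree, `ω(Nm)` odd, `Nm ∣ N`) and `ξ = brandtXi (N/Nm) Nm (a_n(E_(a,b)))`:
`cps ξ · T ≤ C_ε N^(2+ε)`, where `cps n = n / (2^{v₂ n} 3^{v₃ n})` is the prime-to-`6` part and
`T = T(E_(a,b)) = ∏_{q ∣ N} v_q(Δ_min(E_(a,b)))` is the full Tamagawa-exponent product.

CHILDREN (the three hypotheses below, verbatim the `statement`s filed with `route edit --split SteinbergCore`):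
* `XiDegreeComparison` (KNOWN IN PRINT, formal debt): whenever `ξ ≠ 0`, a minimal-degree parametrisation datum `D` of
  `E_(a,b)` at level `N` exists and `cps ξ ≤ C_ε N^ε · cps(D.deg) · T³`.  In print: `ξ(N⁺,N⁻) = δ_(D',M') · i_r² / c_r(A)`
  for `r ∣ N⁻`, `D' = N⁻/r`, `M' = N⁺ r` (Takahashi 2001 Thm 2.3 / Grothendieck's monodromy pairing on `X_r(J₀^{D'}(M'))`);
  `δ_(1,N) / δ_(D',M') = γ · ∏_{p ∣ D'} c_p` with the peeling identities `δ_(d,prM)/δ_(dpr,M) = c_p c_r / (i_p² j_r²)`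
  (Ribet–Takahashi 1997 Thm 2 = Pasten 2024 Prop 6.13), where the image and cokernel terms `i_p, j_r` divide the
  component orders `c_p(A), c_r(A)` of curves in the class (`c_p(A)/c_p(E)` of height `≤ 163`, Pasten L. 6.8), so
  `δ_(D',M') ∣ δ_(1,N) ∏ i² j²`, `ξ ∣ δ_(D',M') i_r` and `cps ξ ≤ cps(δ_(1,N)) · 163^{3ω(N)} · T³` UNCONDITIONALLY and in
  every corner (no irreducibility, no `p ∤ N`, composite `Nm` and `N/Nm = 2^k` included); `δ_(1,N) ∣ D.deg` for every
  datum of `E_(a,b)` (optimal quotient), `163^{3ω(N)} ≤ C_ε N^ε`.  The slack `N^ε · T³` is deliberate: the exact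
  comparison `cps ξ ≤ cps(deg_min)` of the avatar card can fail at composite `Nm` through the cokernels `j_p`
  (Hamidi 2026: `j_p > 1` occurs).
* `PrimeToSixDegreeBound` (the abc-STRENGTH ATOM, Brandt-free): `cps(D.deg) ≤ C_ε N^(2+ε)` for every minimal datum `D`
  of `E_(a,b)` at level `N` — Frey's degree conjecture on Frey curves with the `{2,3}`-part of the degree forgiven; implied
  by the route target `FreyDegreeBound` (`primeToSixDegreeBound_of_minimalDegreeBound`), implies nothing cheaper.
* `AbcValuationProduct` (SHARED MILESTONE, verbatim stmt-ABC-1567 of route ABC/RibetTakahashiSplit):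
  `∏_{p ∣ abc} v_p(abc) ≤ K_ε rad(abc)^ε` for abc triples; it closes from that route's cruxes by the landed
  `abcValuationProduct_of_many_few`, and gives the Frey allowance `T ≤ C_ε N^ε` by the landed
  `stub_allTamExp_of_valuationProduct` (Theorems/DefiniteXiXiStrongBoundAllTamExp.lean).

THEOREMS: `steinbergCore_of_subs_frey` (children with the Frey-curve form of the T-bound), `steinbergCore_of_subs`
(children exactly as filed: comparison, P6, AbcValuationProduct) — both pure algebra
(`cps ξ · T ≤ C₀ N^{ε/4} cps(deg) T⁴ ≤ C₀ C₁ C₂⁴ N^{ε/4 + 2 + ε/4 + 4·ε/8}`; the `ξ = 0` branch has left side `0`);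
`primeToSixDegreeBound_of_minimalDegreeBound` (the degree bound for minimal data — the conclusion of the route's
`DefiniteGlue` — implies P6, `cps n ≤ n`).  HONESTY: the conjunction of the children is STRONGER than the crux by the
T-gap (the crux forces only `T ≤ C_ε N^(2+ε)` where `ξ ≠ 0`, `Cruxes/SteinbergCore/Disproof.lean §C`), and the atom
`PrimeToSixDegreeBound` is abc-strength (census: no strategy short of Szpiro on Frey curves is known for it).
No new definitions.  Landed by the line lead (prover-line-stmt-ABC-15024-c1-0, line `p6_tamagawa_split`) verbatim from
the strategist's `Cruxes/SteinbergCore/SplitGlue.lean`, with `steinbergCore_of_subs` written in arrow form so that its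
header is the registered stub signature (same constant type as the binder form; `--glue-by` unaffected).
-/

-- `Summit.<Summit>.<Problem>` is the mandated summit-side namespace (CONVENTIONS §2); for the single-conjunct
-- summit `ABC` the two coincide, so the duplicate `ABC.ABC` is deliberate.
set_option linter.dupNamespace false

namespace Summit.ABC.ABC.Theorems

open Literature.NumberTheory.EllipticCurves Literature.NumberTheory.Automorphic
open Literature.NumberTheory.EllipticCurves.ModularForms

/-- **The degree bound for minimal data implies the prime-to-6 atom.**  If every minimal-degree datum `D` of
`E_(a,b)` at its conductor level satisfies `deg D ≤ C_ε N^(2+ε)` (the conclusion of `DefiniteXi.DefiniteGlue`, hence a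
consequence of the route target `FreyDegreeBound` together with `FreyModularity`), then
`cps(deg D) ≤ C_ε N^(2+ε)` for the same data, since `cps n = n / (2^{v₂ n} 3^{v₃ n}) ≤ n`. [folklore] -/
theorem primeToSixDegreeBound_of_minimalDegreeBound
    (h : ∀ ε : ℝ, 0 < ε → ∃ C : ℝ, ∀ a b : ℤ, IsCoprime a b → a * b * (a + b) ≠ 0 →
      ∀ (N : ℕ) [NeZero N], (freyCurve a b).conductorNorm ℤ = N →
      ∀ D : ModularParametrizationData (freyCurve a b) N,
        (∀ D' : ModularParametrizationData (freyCurve a b) N, D.deg ≤ D'.deg) →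
        (D.deg : ℝ) ≤ C * (N : ℝ) ^ (2 + ε)) :
    ∀ ε : ℝ, 0 < ε → ∃ C : ℝ, ∀ a b : ℤ, IsCoprime a b → a * b * (a + b) ≠ 0 → ∀ (N : ℕ) [NeZero N],
      (Literature.NumberTheory.EllipticCurves.freyCurve a b).conductorNorm ℤ = N →
      ∀ D : Literature.NumberTheory.EllipticCurves.ModularForms.ModularParametrizationData
        (Literature.NumberTheory.EllipticCurves.freyCurve a b) N,
        (∀ D' : Literature.NumberTheory.EllipticCurves.ModularForms.ModularParametrizationData
          (Literature.NumberTheory.EllipticCurves.freyCurve a b) N, D.deg ≤ D'.deg) →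
        ((D.deg / (ordProj[2] D.deg * ordProj[3] D.deg) : ℕ) : ℝ) ≤ C * (N : ℝ) ^ (2 + ε) := by
  intro ε hε
  obtain ⟨C, hC⟩ := h ε hε
  refine ⟨C, ?_⟩
  intro a b hab h0 N _ hN D hDmin
  refine le_trans ?_ (hC a b hab h0 N hN D hDmin)
  exact_mod_cast Nat.div_le_self _ _

/-- **Typed split of `SteinbergCore`, Frey form of the allowance.**  Hypotheses, in order:
(1) the definite comparison away from `6` with slack, `ξ ≠ 0 → ∃ D minimal, cps ξ ≤ C_ε N^ε · cps(deg D) · T³`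
(known in print: Takahashi 2001 Thm 2.3, Ribet–Takahashi 1997 Thm 2 = Pasten 2024 Prop 6.13, Pasten L. 6.8,
optimal-quotient factorisation; formal debt); (2) `PrimeToSixDegreeBound`, the prime-to-`6` part of the minimal modular
degree of `E_(a,b)` is `≤ C_ε N^(2+ε)` (abc-strength atom); (3) the Frey allowance `T(E_(a,b)) ≤ C_ε N^ε`.
Conclusion: the route decl `DefiniteXi.SteinbergCore`, for EVERY admissible `Nm`.  Proof: at `ξ = 0` the left side is
`0`; otherwise `cps ξ · T ≤ C₀ N^{ε/4} cps(deg D) T³ · T ≤ C₀ N^{ε/4} · C₁ N^{2+ε/4} · (C₂ N^{ε/8})⁴`. [folklore] -/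
theorem steinbergCore_of_subs_frey
    (hC : ∀ ε : ℝ, 0 < ε → ∃ C : ℝ, ∀ a b : ℤ, IsCoprime a b → a * b * (a + b) ≠ 0 → ∀ (N : ℕ) [NeZero N],
      (Literature.NumberTheory.EllipticCurves.freyCurve a b).conductorNorm ℤ = N →
      ∀ Nm : ℕ, Odd Nm → Squarefree Nm → Odd Nm.primeFactors.card → Nm ∣ N →
      Literature.NumberTheory.Automorphic.brandtXi (N / Nm) Nm
          (fun n => (Literature.NumberTheory.EllipticCurves.freyCurve a b).LFunction n) ≠ 0 →
      ∃ D : Literature.NumberTheory.EllipticCurves.ModularForms.ModularParametrizationData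
        (Literature.NumberTheory.EllipticCurves.freyCurve a b) N,
        (∀ D' : Literature.NumberTheory.EllipticCurves.ModularForms.ModularParametrizationData
          (Literature.NumberTheory.EllipticCurves.freyCurve a b) N, D.deg ≤ D'.deg) ∧
        ((Literature.NumberTheory.Automorphic.brandtXi (N / Nm) Nm
              (fun n => (Literature.NumberTheory.EllipticCurves.freyCurve a b).LFunction n) /
            (ordProj[2] (Literature.NumberTheory.Automorphic.brandtXi (N / Nm) Nm
                (fun n => (Literature.NumberTheory.EllipticCurves.freyCurve a b).LFunction n)) *
              ordProj[3] (Literature.NumberTheory.Automorphic.brandtXi (N / Nm) Nm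
                (fun n => (Literature.NumberTheory.EllipticCurves.freyCurve a b).LFunction n))) : ℕ) : ℝ) ≤
          C * (N : ℝ) ^ ε * ((D.deg / (ordProj[2] D.deg * ordProj[3] D.deg) : ℕ) : ℝ) *
            ((∏ q ∈ N.primeFactors, ((Literature.NumberTheory.EllipticCurves.freyCurve a b).minimalDiscriminantNorm
              ℤ).factorization q : ℕ) : ℝ) ^ 3)
    (hP : ∀ ε : ℝ, 0 < ε → ∃ C : ℝ, ∀ a b : ℤ, IsCoprime a b → a * b * (a + b) ≠ 0 → ∀ (N : ℕ) [NeZero N],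
      (Literature.NumberTheory.EllipticCurves.freyCurve a b).conductorNorm ℤ = N →
      ∀ D : Literature.NumberTheory.EllipticCurves.ModularForms.ModularParametrizationData
        (Literature.NumberTheory.EllipticCurves.freyCurve a b) N,
        (∀ D' : Literature.NumberTheory.EllipticCurves.ModularForms.ModularParametrizationData
          (Literature.NumberTheory.EllipticCurves.freyCurve a b) N, D.deg ≤ D'.deg) →
        ((D.deg / (ordProj[2] D.deg * ordProj[3] D.deg) : ℕ) : ℝ) ≤ C * (N : ℝ) ^ (2 + ε))
    (hT : ∀ ε : ℝ, 0 < ε → ∃ C : ℝ, ∀ a b : ℤ, IsCoprime a b → a * b * (a + b) ≠ 0 → ∀ (N : ℕ) [NeZero N],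
      (Literature.NumberTheory.EllipticCurves.freyCurve a b).conductorNorm ℤ = N →
      ((∏ q ∈ N.primeFactors, ((Literature.NumberTheory.EllipticCurves.freyCurve a b).minimalDiscriminantNorm
        ℤ).factorization q : ℕ) : ℝ) ≤ C * (N : ℝ) ^ ε) :
    Summit.ABC.ABC.Theses.DefiniteXi.SteinbergCore := by
  intro ε hε
  obtain ⟨C₀, hC₀⟩ := hC (ε / 4) (by linarith)
  obtain ⟨C₁, hC₁⟩ := hP (ε / 4) (by linarith)
  obtain ⟨C₂, hC₂⟩ := hT (ε / 8) (by linarith)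
  refine ⟨max C₀ 0 * max C₁ 0 * max C₂ 0 ^ 4, ?_⟩
  intro a b hab h0 N _ hN Nm hodd hsq hcard hdvd
  have hNpos : (0 : ℝ) < (N : ℝ) := by exact_mod_cast Nat.pos_of_ne_zero (NeZero.ne N)
  set ξ : ℕ := brandtXi (N / Nm) Nm (fun n => (freyCurve a b).LFunction n) with hξ
  set T : ℕ := ∏ q ∈ N.primeFactors, ((freyCurve a b).minimalDiscriminantNorm ℤ).factorization q with hTdef
  -- exponent bookkeeping: `N^(ε/4) · N^(2 + ε/4) · (N^(ε/8))⁴ = N^(2+ε)`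
  have hfour : ((N : ℝ) ^ (ε / 8)) ^ (4 : ℕ) = (N : ℝ) ^ (ε / 2) := by
    rw [← Real.rpow_natCast ((N : ℝ) ^ (ε / 8)) 4, ← Real.rpow_mul hNpos.le]
    congr 1
    push_cast
    ring
  have hsplit : (N : ℝ) ^ (ε / 4) * (N : ℝ) ^ (2 + ε / 4) * ((N : ℝ) ^ (ε / 8)) ^ (4 : ℕ) =
      (N : ℝ) ^ (2 + ε) := by
    rw [hfour, ← Real.rpow_add hNpos, ← Real.rpow_add hNpos]
    ring_nf
  have hRHS0 : (0 : ℝ) ≤ max C₀ 0 * max C₁ 0 * max C₂ 0 ^ 4 * (N : ℝ) ^ (2 + ε) := by positivity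
  have hT0 : (0 : ℝ) ≤ (T : ℝ) := by positivity
  have hTle : (T : ℝ) ≤ max C₂ 0 * (N : ℝ) ^ (ε / 8) := by
    refine (hC₂ a b hab h0 N hN).trans ?_
    exact mul_le_mul_of_nonneg_right (le_max_left _ _) (by positivity)
  by_cases hξ0 : ξ = 0
  · -- junk branch: no eigen-line (`ξ = 0`), the left side vanishes
    have : ξ / (ordProj[2] ξ * ordProj[3] ξ) = 0 := by rw [hξ0, Nat.zero_div]
    rw [this]
    simpa using hRHS0
  · obtain ⟨D, hDmin, hcmp⟩ := hC₀ a b hab h0 N hN Nm hodd hsq hcard hdvd hξ0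
    have hP' : ((D.deg / (ordProj[2] D.deg * ordProj[3] D.deg) : ℕ) : ℝ) ≤
        max C₁ 0 * (N : ℝ) ^ (2 + ε / 4) :=
      (hC₁ a b hab h0 N hN D hDmin).trans
        (mul_le_mul_of_nonneg_right (le_max_left _ _) (by positivity))
    have hcmp' : ((ξ / (ordProj[2] ξ * ordProj[3] ξ) : ℕ) : ℝ) ≤
        max C₀ 0 * (N : ℝ) ^ (ε / 4) * ((D.deg / (ordProj[2] D.deg * ordProj[3] D.deg) : ℕ) : ℝ) *
          (T : ℝ) ^ 3 := by
      refine hcmp.trans ?_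
      have h1 : (0 : ℝ) ≤ (N : ℝ) ^ (ε / 4) * ((D.deg / (ordProj[2] D.deg * ordProj[3] D.deg) : ℕ) : ℝ) *
          (T : ℝ) ^ 3 := by positivity
      calc C₀ * (N : ℝ) ^ (ε / 4) * ((D.deg / (ordProj[2] D.deg * ordProj[3] D.deg) : ℕ) : ℝ) * (T : ℝ) ^ 3
          = C₀ * ((N : ℝ) ^ (ε / 4) * ((D.deg / (ordProj[2] D.deg * ordProj[3] D.deg) : ℕ) : ℝ) *
              (T : ℝ) ^ 3) := by ring
        _ ≤ max C₀ 0 * ((N : ℝ) ^ (ε / 4) * ((D.deg / (ordProj[2] D.deg * ordProj[3] D.deg) : ℕ) : ℝ) *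
              (T : ℝ) ^ 3) := mul_le_mul_of_nonneg_right (le_max_left _ _) h1
        _ = _ := by ring
    calc ((ξ / (ordProj[2] ξ * ordProj[3] ξ) : ℕ) : ℝ) * (T : ℝ)
        ≤ (max C₀ 0 * (N : ℝ) ^ (ε / 4) * ((D.deg / (ordProj[2] D.deg * ordProj[3] D.deg) : ℕ) : ℝ) *
            (T : ℝ) ^ 3) * (T : ℝ) := mul_le_mul_of_nonneg_right hcmp' hT0
      _ = max C₀ 0 * (N : ℝ) ^ (ε / 4) * ((D.deg / (ordProj[2] D.deg * ordProj[3] D.deg) : ℕ) : ℝ) *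
            (T : ℝ) ^ (4 : ℕ) := by ring
      _ ≤ max C₀ 0 * (N : ℝ) ^ (ε / 4) * (max C₁ 0 * (N : ℝ) ^ (2 + ε / 4)) *
            (max C₂ 0 * (N : ℝ) ^ (ε / 8)) ^ (4 : ℕ) := by
          gcongr
      _ = max C₀ 0 * max C₁ 0 * max C₂ 0 ^ 4 *
            ((N : ℝ) ^ (ε / 4) * (N : ℝ) ^ (2 + ε / 4) * ((N : ℝ) ^ (ε / 8)) ^ (4 : ℕ)) := by ring
      _ = max C₀ 0 * max C₁ 0 * max C₂ 0 ^ 4 * (N : ℝ) ^ (2 + ε) := by rw [hsplit]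

/-- **Typed split of `SteinbergCore` — the glue filed with `route edit --split` (`--glue-by`).**  Hypotheses, in the
order of the children: (1) `XiDegreeComparison` — the definite comparison away from `6` with slack `N^ε · T³` (known in
print, formal debt); (2) `PrimeToSixDegreeBound` — Frey's degree conjecture away from `6` for minimal data (abc-strength
atom); (3) `AbcValuationProduct` — `∏_{p ∣ abc} v_p(abc) ≤ K_ε rad(abc)^ε` for abc triples (verbatim the milestone
stmt-ABC-1567 of route RibetTakahashiSplit).  Conclusion: `DefiniteXi.SteinbergCore`.  Proof: the landed
`stub_allTamExp_of_valuationProduct` turns (3) into the Frey allowance `T(E_(a,b)) ≤ C_ε N^ε`, then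
`steinbergCore_of_subs_frey`. [folklore] -/
theorem steinbergCore_of_subs :
    (∀ ε : ℝ, 0 < ε → ∃ C : ℝ, ∀ a b : ℤ, IsCoprime a b → a * b * (a + b) ≠ 0 → ∀ (N : ℕ) [NeZero N],
      (Literature.NumberTheory.EllipticCurves.freyCurve a b).conductorNorm ℤ = N →
      ∀ Nm : ℕ, Odd Nm → Squarefree Nm → Odd Nm.primeFactors.card → Nm ∣ N →
      Literature.NumberTheory.Automorphic.brandtXi (N / Nm) Nm
          (fun n => (Literature.NumberTheory.EllipticCurves.freyCurve a b).LFunction n) ≠ 0 →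
      ∃ D : Literature.NumberTheory.EllipticCurves.ModularForms.ModularParametrizationData
        (Literature.NumberTheory.EllipticCurves.freyCurve a b) N,
        (∀ D' : Literature.NumberTheory.EllipticCurves.ModularForms.ModularParametrizationData
          (Literature.NumberTheory.EllipticCurves.freyCurve a b) N, D.deg ≤ D'.deg) ∧
        ((Literature.NumberTheory.Automorphic.brandtXi (N / Nm) Nm
              (fun n => (Literature.NumberTheory.EllipticCurves.freyCurve a b).LFunction n) /
            (ordProj[2] (Literature.NumberTheory.Automorphic.brandtXi (N / Nm) Nm
                (fun n => (Literature.NumberTheory.EllipticCurves.freyCurve a b).LFunction n)) *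
              ordProj[3] (Literature.NumberTheory.Automorphic.brandtXi (N / Nm) Nm
                (fun n => (Literature.NumberTheory.EllipticCurves.freyCurve a b).LFunction n))) : ℕ) : ℝ) ≤
          C * (N : ℝ) ^ ε * ((D.deg / (ordProj[2] D.deg * ordProj[3] D.deg) : ℕ) : ℝ) *
            ((∏ q ∈ N.primeFactors, ((Literature.NumberTheory.EllipticCurves.freyCurve a b).minimalDiscriminantNorm
              ℤ).factorization q : ℕ) : ℝ) ^ 3) →
    (∀ ε : ℝ, 0 < ε → ∃ C : ℝ, ∀ a b : ℤ, IsCoprime a b → a * b * (a + b) ≠ 0 → ∀ (N : ℕ) [NeZero N],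
      (Literature.NumberTheory.EllipticCurves.freyCurve a b).conductorNorm ℤ = N →
      ∀ D : Literature.NumberTheory.EllipticCurves.ModularForms.ModularParametrizationData
        (Literature.NumberTheory.EllipticCurves.freyCurve a b) N,
        (∀ D' : Literature.NumberTheory.EllipticCurves.ModularForms.ModularParametrizationData
          (Literature.NumberTheory.EllipticCurves.freyCurve a b) N, D.deg ≤ D'.deg) →
        ((D.deg / (ordProj[2] D.deg * ordProj[3] D.deg) : ℕ) : ℝ) ≤ C * (N : ℝ) ^ (2 + ε)) →
    (∀ ε : ℝ, 0 < ε → ∃ K : ℝ, ∀ a b c : ℕ, Literature.NumberTheory.DiophantineGeometry.IsABCTriple a b c →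
      ((∏ p ∈ (a * b * c).primeFactors, (a * b * c).factorization p : ℕ) : ℝ) ≤
        K * ((Literature.NumberTheory.DiophantineGeometry.rad a b c : ℕ) : ℝ) ^ ε) →
    Summit.ABC.ABC.Theses.DefiniteXi.SteinbergCore :=
  fun hC hP hAVP =>
    steinbergCore_of_subs_frey hC hP (stub_allTamExp_of_valuationProduct hAVP)

end Summit.ABC.ABC.Theorems
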